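import Summits.ABC.StewartYu.PadicW80Numeric3
import Summits.ABC.StewartYu.PadicW80Numeric
import Literature.NumberTheory.Transcendental.PadicCW77KStep
import HarnessLib

/-!
# The `q = 3` (`p = 2`) parameter record — the numerical inequalities in the EXACT shape of p2-g3's
# `KFinal3` / `thirdStep_of_numerics` (weight radius `4`, crude conditioning at the RANGE), at HALF multiplicity

Support file (theorems only; no named facts), cell `abc-stewartyu` (p1; crux `W80Two` stmt-ABC-19486; design memo
HOME/p1/S2-q3-record-design.md).  p2-g3's landed `2`-adic k-step (`PadicTwoKStep`/`PadicTwoMain.KFinal3`,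
`PadicTwoAssembly.kFinal3_of_log_ineq`) has the two branches
(1) `(hL_b + t + condExp 2 N t)·log 2 + log(Dmax·Mmax) < U` and (2) `hL_b·log 8 + log(Dmax·Mmax) < #nodes·t·log 4`
with `N = 3^{k+J} S₀` the RANGE (so `condExp 2 N t·log 2 ≤ N·t·log 2 + t·log 2N`, `N = (3/2)·#nodes`) and the
Schwarz weight radius `4` (gain `log 4` per zero, cost `8^{hL_b}`).  With the full multiplicity `t_J` of the record
branch (1) would need `(3/2)(8/3)·log 2 + 1/2 ≈ 3.27 > 3` units at the third step; at HALF multiplicity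
`t = ⌊t_J/2⌋` (the pack's choice; the room `⌊T/3^{J+1}⌋ + (d+1)t ≤ ⌊T/3ᴶ⌋` only improves) both branches close
for every `k ≤ d` with any threshold budget `B ≤ 𝔘/16 + 3ᵏ𝔘/2` (`logDM3_le_budget`, `bthird_le_budget3'`):
`two_le_tJ3`, `room3_half`, `KT3_half_le/ge` (`kpts·⌊t_J/2⌋ ∈ [5/4, 4/3]·3ᵏ𝔘/ℓ`), `kpts3_eq_two_mul`,
`condExp_range_log_le`, and the targets **`kstep3_h1`**, **`kstep3_h2`** (`ℓ = 1`).
Everything is [folklore] arithmetic on [cite: Waldschmidt1980, Lemma 3.6–3.7 (pp. 272–273)] and [cite: Yu1989, §3].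
-/

noncomputable section

open Finset Real
open Literature.NumberTheory.Transcendental
open Literature.NumberTheory.Transcendental.PadicCW77 (condExp)

namespace Summit.ABC.StewartYu

open PadicW80Par (cTp cSp cLp cLp' Ap mRp condSum_mul_log_le)

namespace PadicW80ParL

variable {d : ℕ} (P : PadicW80ParL d)

/-! ### Half multiplicity -/

/-- `2 ≤ t_J` for `J < J₀` (indeed `t_J ≥ 2¹⁰ m`). [folklore] -/
theorem two_le_tJ3 {J : ℕ} (hJ : J < P.J₀3) : 2 ≤ P.tJ3 J := by
  unfold tJ3
  rw [Nat.le_div_iff_mul_le (by omega)]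
  have := P.TJ3_succ_ge hJ
  nlinarith

/-- `1 ≤ ⌊t_J/2⌋` for `J < J₀`. [folklore] -/
theorem one_le_tJ3_half {J : ℕ} (hJ : J < P.J₀3) : 1 ≤ P.tJ3 J / 2 := by
  have := P.two_le_tJ3 hJ; omega

/-- The room at half multiplicity: `⌊T/3^{J+1}⌋ + (d+1)·⌊t_J/2⌋ ≤ ⌊T/3ᴶ⌋`. [cite: Yu1989, §3] -/
theorem room3_half (J : ℕ) : P.T3 / 3 ^ (J + 1) + (d + 1) * (P.tJ3 J / 2) ≤ P.T3 / 3 ^ J := by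
  have h := P.room3 J
  have h2 : (d + 1) * (P.tJ3 J / 2) ≤ (d + 1) * P.tJ3 J := Nat.mul_le_mul_left _ (Nat.div_le_self _ _)
  omega

/-- `⌊t_J/2⌋ ≤ t_J ≤ T`. [folklore] -/
theorem tJ3_half_le_T3 (J : ℕ) : P.tJ3 J / 2 ≤ P.T3 := (Nat.div_le_self _ _).trans (P.tJ3_le_T3 J)

/-- `2·(3^{k+J}·S₀/3) = kpts3 J k` (`3 ∣ S₀`): p2-g3's node count is the record's. [folklore] -/
theorem kpts3_eq_two_mul (J k : ℕ) : 2 * (3 ^ (k + J) * P.S₀3 / 3) = P.kpts3 J k := by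
  unfold kpts3
  have h := P.S₀3_eq_three_mul
  conv_lhs => rw [h]
  rw [show 3 ^ (k + J) * (3 * (P.S₀3 / 3)) = 3 ^ (k + J) * (P.S₀3 / 3) * 3 by ring, Nat.mul_div_cancel _ (by norm_num)]
  ring

/-- **`kpts · ⌊t_J/2⌋ ≤ (4/3)·3ᵏ 𝔘/ℓ`.** [cite: Waldschmidt1980, Lemma 3.5 (p. 271)] -/
theorem KT3_half_le (J k : ℕ) : (P.kpts3 J k : ℝ) * ((P.tJ3 J / 2 : ℕ) : ℝ) ≤ 4 / 3 * 3 ^ k * (P.𝔘3 / P.ℓ) := by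
  have h := P.KT3_le J k
  have h2 : ((P.tJ3 J / 2 : ℕ) : ℝ) ≤ (P.tJ3 J : ℝ) / 2 := by
    have := Nat.cast_div_le (α := ℝ) (m := P.tJ3 J) (n := 2); push_cast at this; exact this
  have hk : (0 : ℝ) ≤ P.kpts3 J k := Nat.cast_nonneg _
  calc (P.kpts3 J k : ℝ) * ((P.tJ3 J / 2 : ℕ) : ℝ) ≤ (P.kpts3 J k : ℝ) * ((P.tJ3 J : ℝ) / 2) :=
        mul_le_mul_of_nonneg_left h2 hk
    _ = (P.kpts3 J k : ℝ) * (P.tJ3 J : ℝ) / 2 := by ring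
    _ ≤ 8 / 3 * 3 ^ k * (P.𝔘3 / P.ℓ) / 2 := by gcongr
    _ = 4 / 3 * 3 ^ k * (P.𝔘3 / P.ℓ) := by ring

/-- **`kpts · ⌊t_J/2⌋ ≥ (5/4)·3ᵏ 𝔘/ℓ`** for `J < J₀` (`≥ kpts·(t_J − 1)/2 ≥ (31/64)(8/3)·3ᵏ𝔘/ℓ − kpts/2`, and
`kpts ≤ 2·3ᵏ L_θ S₀/3 ≤ 3ᵏ𝔘/(2¹⁴ℓ)`). [cite: Waldschmidt1980, Lemma 3.5 (p. 271)] -/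
theorem KT3_half_ge {J : ℕ} (hJ : J < P.J₀3) (k : ℕ) :
    5 / 4 * 3 ^ k * (P.𝔘3 / P.ℓ) ≤ (P.kpts3 J k : ℝ) * ((P.tJ3 J / 2 : ℕ) : ℝ) := by
  have h := P.KT3_ge hJ k
  have hℓ := P.ℓ_pos; have hU := P.𝔘3_pos
  -- `⌊t/2⌋ ≥ (t − 1)/2`
  have h2 : ((P.tJ3 J : ℝ) - 1) / 2 ≤ ((P.tJ3 J / 2 : ℕ) : ℝ) := by
    have h1 : P.tJ3 J ≤ P.tJ3 J / 2 * 2 + 1 := by omega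
    have : (P.tJ3 J : ℝ) ≤ (P.tJ3 J / 2 : ℕ) * 2 + 1 := by exact_mod_cast h1
    linarith
  -- `kpts ≤ 3ᵏ 𝔘/(2¹⁴ ℓ)`: `kpts ≤ 2·3^{k+J}·(c_S m nW⋆)`, `3ᴶ ≤ Lθ`, `2 c_S m nW⋆ ≤ S₀`, `Lθ S₀ ℓ ≤ 𝔘/2¹⁴`
  have hk1 := P.kpts3_le_real J k
  have hJL : (3 : ℝ) ^ J ≤ P.Lθ3 := by exact_mod_cast P.three_pow_le_Lθ3 hJ
  have hS₀ := P.S₀3_ge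
  have hLS := P.Lθ3S₀3ℓ_le
  have hcS := P.cS_mul_ge
  have hksmall : (P.kpts3 J k : ℝ) ≤ 3 ^ k * (P.𝔘3 / P.ℓ) / 2 ^ 14 := by
    rw [le_div_iff₀ (by norm_num), mul_div_assoc', le_div_iff₀ hℓ]
    have e : (2 : ℝ) * 3 ^ (k + J) * (cSp * mRp d * P.nWstarℓ) = 3 ^ k * (3 ^ J * (2 * (cSp * mRp d * P.nWstarℓ))) := by
      rw [pow_add]; ring
    rw [e] at hk1
    have h3 : (3 : ℝ) ^ J * (2 * (cSp * mRp d * P.nWstarℓ)) ≤ P.Lθ3 * P.S₀3 :=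
      mul_le_mul hJL hS₀ (by linarith) (Nat.cast_nonneg _)
    have h3k : (0 : ℝ) ≤ 3 ^ k := by positivity
    have h4 : (P.kpts3 J k : ℝ) ≤ 3 ^ k * (P.Lθ3 * P.S₀3) := hk1.trans (mul_le_mul_of_nonneg_left h3 h3k)
    rw [le_div_iff₀ (by norm_num)] at hLS
    calc (P.kpts3 J k : ℝ) * 2 ^ 14 * P.ℓ ≤ 3 ^ k * (P.Lθ3 * P.S₀3) * 2 ^ 14 * P.ℓ := by gcongr
      _ = 3 ^ k * ((P.Lθ3 : ℝ) * P.S₀3 * P.ℓ * 2 ^ 14) := by ring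
      _ ≤ 3 ^ k * P.𝔘3 := mul_le_mul_of_nonneg_left hLS h3k
  have hk0 : (0 : ℝ) ≤ P.kpts3 J k := Nat.cast_nonneg _
  have hmain : (P.kpts3 J k : ℝ) * (((P.tJ3 J : ℝ) - 1) / 2) ≤ (P.kpts3 J k : ℝ) * ((P.tJ3 J / 2 : ℕ) : ℝ) :=
    mul_le_mul_of_nonneg_left h2 hk0
  have e : (P.kpts3 J k : ℝ) * (((P.tJ3 J : ℝ) - 1) / 2) = ((P.kpts3 J k : ℝ) * (P.tJ3 J : ℝ)) / 2 - (P.kpts3 J k : ℝ) / 2 := by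
    ring
  rw [e] at hmain
  have hU' : 0 < P.𝔘3 / P.ℓ := by positivity
  have h3k1 : (1 : ℝ) ≤ 3 ^ k := one_le_pow₀ (by norm_num)
  nlinarith [mul_nonneg (sub_nonneg.mpr h3k1) hU'.le]

/-- **The crude conditioning at the range**: `condExp 2 N t · log 2 ≤ N·t·log 2 + t·log(2N)`, `N = 3^{k+J} S₀`
(`PadicW80Par.condSum_mul_log_le` at `p = 2`). [cite: Yu1990, §3] -/
theorem condExp_range_log_le (J k t : ℕ) :
    ((condExp 2 (3 ^ (k + J) * P.S₀3) t : ℕ) : ℝ) * Real.log 2 ≤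
      ((3 ^ (k + J) * P.S₀3 : ℕ) : ℝ) * t * Real.log 2 + t * Real.log (2 * ((3 ^ (k + J) * P.S₀3 : ℕ) : ℝ)) := by
  have hN : 1 ≤ 3 ^ (k + J) * P.S₀3 := by
    have h1 : 1 ≤ 3 ^ (k + J) := Nat.one_le_pow _ _ (by norm_num)
    have h6 := P.six_le_S₀3
    calc 1 = 1 * 1 := rfl
      _ ≤ 3 ^ (k + J) * P.S₀3 := Nat.mul_le_mul h1 (by omega)
  have h := condSum_mul_log_le (p := 2) le_rfl (3 ^ (k + J) * P.S₀3) t hN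
  unfold condExp
  have e : ((2 : ℕ) : ℝ) - 1 = 1 := by norm_num
  rw [e, div_one] at h
  exact h

/-! ### The two targets of `kFinal3_of_log_ineq` / the third-step log form, at `t = ⌊t_J/2⌋`, `ℓ = 1` -/

/-- **Branch (2) of `KFinal3` / of the third step** at step `k` of level `J < J₀` (`k ≤ d` or any `k`), `ℓ = 1`,
`t = ⌊t_J/2⌋`: for any threshold budget `B ≤ 𝔘/16 + 3ᵏ𝔘/2`,
`hL_b·log 8 + B < (2·(3^{k+J}S₀/3)·t)·log 4` (gain `log 4` per zero, `kpts·t ≥ (5/4)·3ᵏ𝔘`).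
[cite: Waldschmidt1980, Lemma 3.6–3.7 (pp. 272–273)] [cite: Yu1989, §3 Lemma 3.3] -/
theorem kstep3_h2 (hℓ1 : P.ℓ = 1) {J : ℕ} (hJ : J < P.J₀3) (k : ℕ) {B : ℝ}
    (hB : B ≤ P.𝔘3 / 16 + 3 ^ k * P.𝔘3 / 2) :
    ((P.hparℓ * P.Lb3 : ℕ) : ℝ) * Real.log 8 + B <
      ((2 * (3 ^ (k + J) * P.S₀3 / 3) * (P.tJ3 J / 2) : ℕ) : ℝ) * Real.log 4 := by
  have hKT := P.KT3_half_ge hJ k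
  rw [hℓ1, div_one] at hKT
  have hh := P.hLb3_log_two_le hℓ1
  have hU := P.𝔘3_pos
  have h3k : (1 : ℝ) ≤ 3 ^ k := one_le_pow₀ (by norm_num)
  have hl2 : (0.6931471803 : ℝ) < Real.log 2 := Real.log_two_gt_d9
  have hl0 : 0 < Real.log 2 := by linarith
  have e8 : Real.log 8 = 3 * Real.log 2 := by
    rw [show (8 : ℝ) = 2 ^ 3 by norm_num, Real.log_pow]; push_cast; ring
  have e4 : Real.log 4 = 2 * Real.log 2 := by
    rw [show (4 : ℝ) = 2 ^ 2 by norm_num, Real.log_pow]; push_cast; ring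
  rw [e8, e4, P.kpts3_eq_two_mul]
  push_cast
  have hkt0 : (0 : ℝ) ≤ (P.kpts3 J k : ℝ) * ((P.tJ3 J / 2 : ℕ) : ℝ) := by positivity
  have h1 : 5 / 4 * 3 ^ k * P.𝔘3 * 0.6931471803 ≤ (P.kpts3 J k : ℝ) * ((P.tJ3 J / 2 : ℕ) : ℝ) * Real.log 2 := by
    have h0 : (0 : ℝ) ≤ 5 / 4 * 3 ^ k * P.𝔘3 := by positivity
    exact mul_le_mul hKT hl2.le (by norm_num) hkt0
  have h3kU : P.𝔘3 ≤ 3 ^ k * P.𝔘3 := by nlinarith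
  push_cast at h1 hh hkt0
  nlinarith

/-- **Branch (1) of `KFinal3` / of the third step** at step `k ≤ d` of level `J < J₀`, `ℓ = 1`,
`t = ⌊t_J/2⌋`: for any threshold budget `B ≤ 𝔘/16 + 3ᵏ𝔘/2`,
`(hL_b + t + condExp 2 (3^{k+J}S₀) t)·log 2 + B < U` (`N·t·log 2 ≤ (3/2)(4/3)·log 2·3ᵏ𝔘 ≈ 1.39·3ᵏ𝔘`,
`U = 3^{d+1}𝔘`). [cite: Waldschmidt1980, Lemma 3.6–3.7 (pp. 272–273)] [cite: Yu1989, §3] -/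
theorem kstep3_h1 (hℓ1 : P.ℓ = 1) {J : ℕ} (hJ : J < P.J₀3) {k : ℕ} (hk : k ≤ d) {B : ℝ}
    (hB : B ≤ P.𝔘3 / 16 + 3 ^ k * P.𝔘3 / 2) :
    ((P.hparℓ * P.Lb3 + P.tJ3 J / 2 + condExp 2 (3 ^ (k + J) * P.S₀3) (P.tJ3 J / 2) : ℕ) : ℝ) * Real.log 2 + B <
      P.Uℓ := by
  have hKT := P.KT3_half_le J k
  rw [hℓ1, div_one] at hKT
  have hh := P.hLb3_log_two_le hℓ1
  have hcond := P.condExp_range_log_le J k (P.tJ3 J / 2)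
  have hU := P.𝔘3_pos
  have hl2 : Real.log 2 < 0.6931471808 := Real.log_two_lt_d9
  have hl0 : 0 < Real.log 2 := Real.log_pos one_lt_two
  have hl1 : Real.log 2 ≤ 1 := by linarith
  have h3k : (3 : ℝ) ^ k ≤ 3 ^ d := pow_le_pow_right₀ (by norm_num) hk
  -- `t·log 2 ≤ 𝔘/c_T` and `t·log(2N) ≤ 10𝔘/c_T`
  have ht1 : ((P.tJ3 J / 2 : ℕ) : ℝ) ≤ (P.tJ3 J : ℝ) := by exact_mod_cast Nat.div_le_self _ _
  have ht := P.tJ3_log_two_le J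
  have hr := P.tJ3_log_range_le hJ (show k ≤ d + 1 by omega)
  have ht0 : (0 : ℝ) ≤ ((P.tJ3 J / 2 : ℕ) : ℝ) := Nat.cast_nonneg _
  have hlogr0 : 0 ≤ Real.log (2 * (3 ^ (k + J) * P.S₀3)) := by
    apply Real.log_nonneg
    have h1 : (1 : ℝ) ≤ 3 ^ (k + J) := one_le_pow₀ (by norm_num)
    have h6 : (6 : ℝ) ≤ P.S₀3 := by exact_mod_cast P.six_le_S₀3
    nlinarith
  have ht' : ((P.tJ3 J / 2 : ℕ) : ℝ) * Real.log 2 ≤ P.𝔘3 / cTp := (mul_le_mul_of_nonneg_right ht1 hl0.le).trans ht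
  have hr' : ((P.tJ3 J / 2 : ℕ) : ℝ) * Real.log (2 * ((3 ^ (k + J) * P.S₀3 : ℕ) : ℝ)) ≤ 10 * (P.𝔘3 / cTp) := by
    push_cast
    exact (mul_le_mul_of_nonneg_right ht1 hlogr0).trans hr
  -- `N·t ≤ (3/2)·kpts·t ≤ 2·3ᵏ𝔘`
  have hN : ((3 ^ (k + J) * P.S₀3 : ℕ) : ℝ) * ((P.tJ3 J / 2 : ℕ) : ℝ) ≤ 2 * 3 ^ k * P.𝔘3 := by
    have e : ((3 ^ (k + J) * P.S₀3 : ℕ) : ℝ) = 3 / 2 * (P.kpts3 J k : ℝ) := by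
      have h3 := P.three_mul_kpts3 J k
      have : (3 : ℝ) * (P.kpts3 J k : ℝ) = 2 * 3 ^ (k + J) * P.S₀3 := by exact_mod_cast h3
      push_cast; linarith
    rw [e]
    nlinarith
  have hNlog : ((3 ^ (k + J) * P.S₀3 : ℕ) : ℝ) * ((P.tJ3 J / 2 : ℕ) : ℝ) * Real.log 2 ≤ 2 * 3 ^ k * P.𝔘3 * 0.6931471808 := by
    have h0 : (0 : ℝ) ≤ ((3 ^ (k + J) * P.S₀3 : ℕ) : ℝ) * ((P.tJ3 J / 2 : ℕ) : ℝ) := by positivity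
    exact mul_le_mul hN hl2.le hl0.le (by positivity)
  have h3kU : (3 : ℝ) ^ k * P.𝔘3 ≤ 3 ^ d * P.𝔘3 := mul_le_mul_of_nonneg_right h3k hU.le
  have h1d : P.𝔘3 ≤ 3 ^ d * P.𝔘3 := by
    have : (1 : ℝ) ≤ 3 ^ d := one_le_pow₀ (by norm_num)
    nlinarith
  have esplit : ((P.hparℓ * P.Lb3 + P.tJ3 J / 2 + condExp 2 (3 ^ (k + J) * P.S₀3) (P.tJ3 J / 2) : ℕ) : ℝ) * Real.log 2 =
      ((P.hparℓ * P.Lb3 : ℕ) : ℝ) * Real.log 2 + ((P.tJ3 J / 2 : ℕ) : ℝ) * Real.log 2 +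
        ((condExp 2 (3 ^ (k + J) * P.S₀3) (P.tJ3 J / 2) : ℕ) : ℝ) * Real.log 2 := by
    push_cast; ring
  rw [esplit, P.U_eq3, pow_succ]
  unfold cTp at ht' hr'
  linarith

end PadicW80ParL

end Summit.ABC.StewartYu

end
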